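import Mathlib.Algebra.Order.Archimedean.Basic
import Mathlib.Data.NNReal.Defs
import Mathlib.Data.NNRat.Order
import Literature.AlgebraicGeometry.Frobenioids.Monoids
import Literature.AlgebraicGeometry.Frobenioids.ModelFrobenioid
import HarnessLib

/-!
# Frobenioids II, Thm. 1.2 (i)/(iii): monoprime divisor monoids make `Div_B` cofinal

Mochizuki, *The geometry of Frobenioids II*, Kyushu J. Math. **62** (2008), §1, proof of Theorem 1.2
(kurims p. 9) [cite: MochizukiFrdII2008, Thm 1.2 (i) p.9]: "Consideration of the kernel of the
homomorphism of group-like monoids on `D`, `B → Φ^gp`, reveals … since the image monoids of this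
homomorphism are assumed to be nonzero, and `Φ` is monoprime [cf. Example 1.1, (ii)], it follows
immediately that `C` is of quasi-Frobenius-trivial and [strictly] rational type".  The monoid-theoretic
content isolated here: a monoprime monoid `M ≅ ℤ_{≥0}, ℚ_{≥0}, ℝ_{≥0}` ([FrdI] §0 p. 10) is totally
ordered by divisibility and archimedean (`IsMonoprime.exists_dvd_pow`), so a nonzero subgroup of
`M^gp` generated by `Div_B` of invertible rational functions is *cofinal*: every class of `M^gp`
becomes effective after adding `Div_B(u)` for a suitable `u` (`ModelFrobenioid.divB_cofinal`) — the
hypothesis under which `ModelFrobenioidAmpleness.lean` derives `End`-ampleness,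
quasi-Frobenius-triviality and pseudo-terminal objects. PROOF-ONLY; no definitions.
-/

namespace Literature.AlgebraicGeometry.Frobenioids

open CategoryTheory Opposite

universe w v u

/-! ### Monoprime monoids: divisibility is total and archimedean -/

section Monoprime

variable {M : Type w} [CommMonoid M]

/-- Transport: along `e : M ≃* Λ_{≥0}` (written multiplicatively) with `Λ_{≥0}` canonically ordered,
`x ∣ y` in `M` iff `e x ≤ e y`. [cite: MochizukiFrdI2008, §0 p.10] -/
private theorem dvd_iff_le_of_mulEquiv {Λ : Type*} [AddCommMonoid Λ] [PartialOrder Λ]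
    [CanonicallyOrderedAdd Λ] (e : M ≃* Multiplicative Λ) (x y : M) :
    x ∣ y ↔ Multiplicative.toAdd (e x) ≤ Multiplicative.toAdd (e y) := by
  constructor
  · rintro ⟨c, rfl⟩
    rw [map_mul, toAdd_mul]
    exact le_self_add
  · intro h
    obtain ⟨c, hc⟩ := le_iff_exists_add.mp h
    refine ⟨e.symm (Multiplicative.ofAdd c), e.injective ?_⟩
    rw [map_mul, MulEquiv.apply_symm_apply]
    exact Multiplicative.toAdd.injective (by rw [toAdd_mul, toAdd_ofAdd]; exact hc)

/-- Transport of totality and the archimedean property along `e : M ≃* Λ_{≥0}`.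
[cite: MochizukiFrdI2008, §0 p.10] -/
private theorem total_and_arch_of_mulEquiv {Λ : Type*} [AddCommMonoid Λ] [LinearOrder Λ]
    [CanonicallyOrderedAdd Λ] [Archimedean Λ] (e : M ≃* Multiplicative Λ) :
    (∀ a b : M, a ∣ b ∨ b ∣ a) ∧ (∀ c : M, c ≠ 1 → ∀ a : M, ∃ n : ℕ, a ∣ c ^ n) := by
  refine ⟨fun a b => ?_, fun c hc a => ?_⟩
  · rcases le_total (Multiplicative.toAdd (e a)) (Multiplicative.toAdd (e b)) with h | h
    · exact Or.inl ((dvd_iff_le_of_mulEquiv e a b).mpr h)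
    · exact Or.inr ((dvd_iff_le_of_mulEquiv e b a).mpr h)
  · have hc' : 0 < Multiplicative.toAdd (e c) := by
      rw [pos_iff_ne_zero]
      intro h0
      apply hc
      apply e.injective
      rw [map_one]
      exact Multiplicative.toAdd.injective (by rw [h0, toAdd_one])
    obtain ⟨n, hn⟩ := Archimedean.arch (Multiplicative.toAdd (e a)) hc'
    refine ⟨n, (dvd_iff_le_of_mulEquiv e a (c ^ n)).mpr ?_⟩
    rwa [map_pow, toAdd_pow]

/-- In a monoprime monoid any two elements are comparable under divisibility
([FrdI] §0 p. 10: monoprime = `≅ ℤ_{≥0}, ℚ_{≥0}, ℝ_{≥0}`). [cite: MochizukiFrdI2008, §0 p.10] -/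
theorem IsMonoprime.dvd_or_dvd (h : IsMonoprime M) (a b : M) : a ∣ b ∨ b ∣ a := by
  rcases h with ⟨⟨⟨e⟩⟩⟩ | ⟨⟨⟨e⟩⟩⟩ | ⟨⟨⟨e⟩⟩⟩
  · exact (total_and_arch_of_mulEquiv e).1 a b
  · exact (total_and_arch_of_mulEquiv e).1 a b
  · exact (total_and_arch_of_mulEquiv e).1 a b

/-- A monoprime monoid is archimedean: every element divides some power of any element `≠ 1`.
[cite: MochizukiFrdI2008, §0 p.10] -/
theorem IsMonoprime.exists_dvd_pow (h : IsMonoprime M) {c : M} (hc : c ≠ 1) (a : M) :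
    ∃ n : ℕ, a ∣ c ^ n := by
  rcases h with ⟨⟨⟨e⟩⟩⟩ | ⟨⟨⟨e⟩⟩⟩ | ⟨⟨⟨e⟩⟩⟩
  · exact (total_and_arch_of_mulEquiv e).2 c hc a
  · exact (total_and_arch_of_mulEquiv e).2 c hc a
  · exact (total_and_arch_of_mulEquiv e).2 c hc a

/-- Every element of `M^gp` is a formal quotient: `γ · b = a` for some `a, b ∈ M`.
[cite: MochizukiFrdI2008, §0 p.11] -/
theorem grothendieckGroup_exists_mul_of_eq_of (γ : Algebra.GrothendieckGroup M) :
    ∃ a b : M, γ * Algebra.GrothendieckGroup.of b = Algebra.GrothendieckGroup.of a := by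
  induction γ using Localization.induction_on with
  | H y =>
    refine ⟨y.1, y.2, ?_⟩
    rw [Localization.mk_eq_monoidOf_mk'_apply]
    exact Submonoid.LocalizationMap.mk'_spec _ _ _

end Monoprime

/-! ### Cofinality of `Div_B` for a monoprime divisor monoid -/

namespace ModelFrobenioid

variable {D : Type u} [Category.{v} D] {Φ B : Dᵒᵖ ⥤ CommMonCat.{w}} {DivB : B ⟶ monoidGp Φ}

/-- **FrdII Thm. 1.2 (i)/(iii), the monoid-theoretic step**: if `Φ(A)` is monoprime, `B(A)` is
group-like and `Div_B : B(A) → Φ(A)^gp` is nonzero, then `Div_B` is *cofinal* — for every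
`γ ∈ Φ(A)^gp` there are `x ∈ Φ(A)` and `u ∈ B(A)` with `γ + Div_B(u) = x` ("since the image monoids of
this homomorphism are assumed to be nonzero, and `Φ` is monoprime", FrdII p. 9): the image contains
`c` or `-c` for some `c > 0`, and multiples of `c` dominate every element.
[cite: MochizukiFrdII2008, Thm 1.2 (i) p.9] -/
theorem divB_cofinal (A : D) (hM : IsMonoprime (Φ.obj (op A)))
    (hB : ∀ b : B.obj (op A), IsUnit b) (h0 : ∃ b : B.obj (op A), divB Φ B DivB (op A) b ≠ 1)
    (γ : Algebra.GrothendieckGroup (Φ.obj (op A))) :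
    ∃ (x : Φ.obj (op A)) (u : B.obj (op A)),
      γ * divB Φ B DivB (op A) u = Algebra.GrothendieckGroup.of x := by
  obtain ⟨b₀, hb₀⟩ := h0
  -- Step 1: some `u₀` has `Div_B(u₀) = c` effective and `≠ 0`.
  have step1 : ∃ (c : Φ.obj (op A)) (u₀ : B.obj (op A)), c ≠ 1 ∧
      divB Φ B DivB (op A) u₀ = Algebra.GrothendieckGroup.of c := by
    obtain ⟨a, b, hab⟩ := grothendieckGroup_exists_mul_of_eq_of (divB Φ B DivB (op A) b₀)
    rcases hM.dvd_or_dvd b a with ⟨c, rfl⟩ | ⟨c, rfl⟩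
    · -- `a = b c`: `Div_B(b₀) = c`
      refine ⟨c, b₀, ?_, ?_⟩
      · rintro rfl
        apply hb₀
        rw [mul_one] at hab
        exact mul_right_cancel (hab.trans (one_mul _).symm)
      · rw [map_mul, mul_comm (Algebra.GrothendieckGroup.of b)] at hab
        exact mul_right_cancel hab
    · -- `b = a c`: `Div_B(b₀⁻¹) = c`
      obtain ⟨v, hv⟩ := hB b₀
      have h2 : divB Φ B DivB (op A) b₀ * Algebra.GrothendieckGroup.of c = 1 := by
        rw [map_mul, ← mul_assoc, mul_right_comm] at hab
        exact mul_right_cancel (hab.trans (one_mul _).symm)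
      refine ⟨c, ↑v⁻¹, ?_, ?_⟩
      · rintro rfl
        apply hb₀
        rwa [map_one, mul_one] at h2
      · rw [map_units_inv, hv]
        exact inv_eq_of_mul_eq_one_right h2
  obtain ⟨c, u₀, hc, hu₀⟩ := step1
  -- Step 2: write `γ = a' / b'` and dominate `b'` by a power of `c`.
  obtain ⟨a', b', hγ⟩ := grothendieckGroup_exists_mul_of_eq_of γ
  obtain ⟨n, ⟨m, hm⟩⟩ := hM.exists_dvd_pow hc b'
  refine ⟨a' * m, u₀ ^ n, ?_⟩
  rw [map_pow, hu₀, ← map_pow, hm, map_mul, map_mul, ← mul_assoc, hγ]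

end ModelFrobenioid

end Literature.AlgebraicGeometry.Frobenioids
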